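import Mathlib.Algebra.Polynomial.Laurent
import Mathlib.RingTheory.Nullstellensatz
import Mathlib.Analysis.Normed.Module.Connected
import Mathlib.LinearAlgebra.Complex.FiniteDimensional
import Mathlib.Tactic.Module
import Literature.AlgebraicGeometry.Motives.AffineAlgebraicDeRhamAffineSpaceProofs
import Literature.AlgebraicTopology.SingularHomology.SphereHomology
import Literature.AlgebraicTopology.SingularHomology.UniversalCoefficientsField
import Literature.AlgebraicTopology.SingularHomology.CohomologyOfPoint
import Literature.AlgebraicTopology.SingularHomology.ExcisionMayerVietorisProofs
import Literature.AlgebraicTopology.SingularHomology.CohomologyHomotopyInvariance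
import HarnessLib

/-!
# Grothendieck's comparison theorem for the multiplicative group `𝔾_m = V(xy − 1)`

Topic `Literature/AlgebraicGeometry/Motives`. Partial progress on the named fact
`Literature.AlgebraicGeometry.Motives.AffineAlgebraicDeRham` [Grothendieck1966, Thm 1]: the first
instance of positive dimension which is not an affine space, the smooth affine curve
`𝔾_m = Spec ℂ[x, y]/(xy − 1) ≅ Spec ℂ[t, t⁻¹]`, whose complex points `ℂˣ ≃ S¹` have
`H⁰ = H¹ = ℂ` and `H^p = 0` for `p ≥ 2` on BOTH sides (`AffineAlgebraicDeRham.gm`). Everything is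
proved; no named facts are introduced.

## The algebraic side (`K` a field of characteristic `0`, `I = (xy − 1) ⊆ K[x, y]`)

Following [Hartshorne1975, Ch. II §7, p. 53 and Prop. 7.1] (the de Rham complex of `k[t, t⁻¹]`):

* `Gm.gmParam` — the parametrisation `K[x, y] → K[T; T⁻¹]`, `x ↦ T`, `y ↦ T⁻¹`; its kernel is
  exactly `I` (`Gm.gmParam_eq_zero_iff`, via the inverse `K[T;T⁻¹] → K[x,y]/I` furnished by
  Mathlib's `LaurentPolynomial.eval₂` at the unit `x̄`).
* `Gm.laurentDeriv`, `Gm.laurentRes` — `d/dT` and the residue `Res_{T=0}` (coefficient of `T⁻¹`)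
  on Laurent polynomials: `ker (d/dT) = K` and `im (d/dT) = ker Res` in characteristic `0`.
* `Gm.gmRestrict` — restriction of a polynomial `1`-form `ω = g dx + h dy` to `𝔾_m` written in the
  basis `dT`: `ω|_{𝔾_m} = (g(T, T⁻¹) − T⁻² h(T, T⁻¹)) dT`; the chain rule
  `(df)|_{𝔾_m} = d/dT (f(T, T⁻¹)) dT` (`Gm.gmRestrict_extDeriv_ofPoly`); forms vanishing on
  `V(I)` restrict to `0`.
* `Gm.exists_isExactOn_sub_smul_ydx` — every polynomial `1`-form is, modulo forms exact on `𝔾_m`,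
  a constant multiple of `y dx = dT/T`.
* Hence `H¹_dR(𝔾_m) ≃ K` by the residue (`Gm.deRhamCohomologyOneEquiv`), `H⁰_dR(𝔾_m) ≃ K`
  (`Gm.deRhamCohomologyZeroEquiv`), and `H^p_dR = 0` for `p ≥ 2` (`Ω²_{𝔾_m} = 0`:
  `Gm.vanishingForms_two_eq_top`).

## The topological side

`V(xy − 1)(ℂ) ≃ₜ ℂ ∖ 0 ≃ₜ ℝ² ∖ 0 ≃ S¹` (`Gm.zeroLocusHomeomorph`, the tree's
`sphereHomotopyEquivPunctured`), and `H⁰(S¹; ℂ) = H¹(S¹; ℂ) = ℂ`, `H^p(S¹; ℂ) = 0` (`p ≥ 2`) from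
the tree's `Hₙ(Sⁿ) ≅ M` [HatcherAT2002, Cor. 2.14] and universal coefficients over a field
[HatcherAT2002, Thm. 3.2].

## References

* A. Grothendieck, *On the de Rham cohomology of algebraic varieties*, Publ. Math. IHÉS 29 (1966)
  95–103, Thm 1. [Grothendieck1966]
* R. Hartshorne, *On the De Rham cohomology of algebraic varieties*, Publ. Math. IHÉS 45 (1975)
  5–99, Ch. II §7 (p. 53) and Prop. 7.1. [Hartshorne1975]
* A. Hatcher, *Algebraic Topology*, CUP 2002, Cor. 2.14, §3.1 Thm. 3.2. [HatcherAT2002]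
-/

noncomputable section

open MvPolynomial LaurentPolynomial

namespace Literature.AlgebraicGeometry.Motives

namespace AffineDeRham

namespace Gm

variable (K : Type*) [Field K]

/-! ### The coordinate ring `K[x, y]/(xy − 1) ≅ K[T; T⁻¹]` -/

/-- The ideal `(xy − 1) ⊆ K[x, y]` of the multiplicative group `𝔾_m ⊆ 𝔸²`. [folklore] -/
def gmIdeal : Ideal (MvPolynomial (Fin 2) K) :=
  Ideal.span {X 0 * X 1 - 1}

/-- `xy − 1 ∈ (xy − 1)`. [folklore] -/
theorem eqn_mem_gmIdeal : (X 0 * X 1 - 1 : MvPolynomial (Fin 2) K) ∈ gmIdeal K :=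
  Ideal.subset_span rfl

/-- The parametrisation `t ↦ (t, t⁻¹)` of `𝔾_m`: the `K`-algebra map `K[x, y] → K[T; T⁻¹]`,
`x ↦ T`, `y ↦ T⁻¹`. [folklore] -/
def gmParam : MvPolynomial (Fin 2) K →ₐ[K] K[T;T⁻¹] :=
  aeval ![T 1, T (-1)]

/-- `x ↦ T`. [folklore] -/
@[simp]
theorem gmParam_X_zero : gmParam K (X 0) = T 1 := by
  simp [gmParam]

/-- `y ↦ T⁻¹`. [folklore] -/
@[simp]
theorem gmParam_X_one : gmParam K (X 1) = T (-1) := by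
  simp [gmParam]

/-- Constants go to constants. [folklore] -/
@[simp]
theorem gmParam_C (a : K) : gmParam K (C a) = LaurentPolynomial.C a := by
  rw [gmParam, algHom_C, LaurentPolynomial.algebraMap_apply, Algebra.algebraMap_self_apply]

/-- `xy − 1 ↦ T·T⁻¹ − 1 = 0`. [folklore] -/
theorem gmParam_eqn : gmParam K (X 0 * X 1 - 1) = 0 := by
  rw [map_sub, map_mul, gmParam_X_zero, gmParam_X_one, ← T_add, map_one]
  simp [T_zero]

/-- The parametrisation kills the ideal `(xy − 1)`. [folklore] -/
theorem gmParam_eq_zero_of_mem {f : MvPolynomial (Fin 2) K} (hf : f ∈ gmIdeal K) :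
    gmParam K f = 0 := by
  obtain ⟨g, rfl⟩ := Ideal.mem_span_singleton'.mp hf
  rw [map_mul, gmParam_eqn, mul_zero]

/-- `x̄ ȳ = 1` in `K[x, y]/(xy − 1)`. [folklore] -/
theorem mk_X_zero_mul_mk_X_one :
    Ideal.Quotient.mk (gmIdeal K) (X 0) * Ideal.Quotient.mk (gmIdeal K) (X 1) = 1 := by
  rw [← map_mul, ← map_one (Ideal.Quotient.mk (gmIdeal K)), Ideal.Quotient.eq]
  exact eqn_mem_gmIdeal K

/-- The unit `x̄` of `K[x, y]/(xy − 1)`, with inverse `ȳ`. [folklore] -/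
def unitX : (MvPolynomial (Fin 2) K ⧸ gmIdeal K)ˣ where
  val := Ideal.Quotient.mk (gmIdeal K) (X 0)
  inv := Ideal.Quotient.mk (gmIdeal K) (X 1)
  val_inv := mk_X_zero_mul_mk_X_one K
  inv_val := by rw [mul_comm]; exact mk_X_zero_mul_mk_X_one K

/-- The inverse `K[T; T⁻¹] → K[x, y]/(xy − 1)`, `T ↦ x̄`, `T⁻¹ ↦ ȳ` (Mathlib's evaluation of
Laurent polynomials at a unit). [folklore] -/
def gmParamInv : K[T;T⁻¹] →+* MvPolynomial (Fin 2) K ⧸ gmIdeal K :=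
  LaurentPolynomial.eval₂ (algebraMap K (MvPolynomial (Fin 2) K ⧸ gmIdeal K)) (unitX K)

/-- `gmParamInv ∘ gmParam` is the quotient map `K[x, y] → K[x, y]/(xy − 1)`. [folklore] -/
theorem gmParamInv_comp_gmParam :
    (gmParamInv K).comp (gmParam K : MvPolynomial (Fin 2) K →+* K[T;T⁻¹]) =
      Ideal.Quotient.mk (gmIdeal K) := by
  refine MvPolynomial.ringHom_ext (fun a => ?_) (fun i => ?_)
  · rw [RingHom.comp_apply, RingHom.coe_coe, gmParam_C, gmParamInv, LaurentPolynomial.eval₂_C]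
    rfl
  · fin_cases i
    · rw [RingHom.comp_apply, RingHom.coe_coe]
      change gmParamInv K (gmParam K (X 0)) = _
      rw [gmParam_X_zero, gmParamInv, show (1 : ℤ) = ((1 : ℕ) : ℤ) from rfl, eval₂_T_n, pow_one]
      rfl
    · rw [RingHom.comp_apply, RingHom.coe_coe]
      change gmParamInv K (gmParam K (X 1)) = _
      rw [gmParam_X_one, gmParamInv, show (-1 : ℤ) = -((1 : ℕ) : ℤ) from rfl, eval₂_T_neg_n,
        pow_one]
      rfl

/-- **`ker (K[x, y] → K[T; T⁻¹]) = (xy − 1)`**: a polynomial vanishing on the parametrised curve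
`t ↦ (t, t⁻¹)` is a multiple of `xy − 1`. [folklore] -/
theorem gmParam_eq_zero_iff {f : MvPolynomial (Fin 2) K} : gmParam K f = 0 ↔ f ∈ gmIdeal K := by
  refine ⟨fun h => ?_, gmParam_eq_zero_of_mem K⟩
  rw [← Ideal.Quotient.eq_zero_iff_mem, ← gmParamInv_comp_gmParam, RingHom.comp_apply,
    RingHom.coe_coe, h, map_zero]

/-- `(xy − 1)` is a proper ideal. [folklore] -/
theorem gmIdeal_ne_top : gmIdeal K ≠ ⊤ := by
  intro h
  have h1 : gmParam K 1 = 0 := gmParam_eq_zero_of_mem K (h ▸ Submodule.mem_top)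
  rw [map_one] at h1
  exact one_ne_zero h1

/-! ### `d/dT` and the residue on Laurent polynomials -/

/-- The coefficient of `T^m` in `a T^n`. [folklore] -/
theorem coeff_C_mul_T (a : K) (n m : ℤ) :
    (LaurentPolynomial.C a * T n).coeff m = if n = m then a else 0 := by
  rw [← single_eq_C_mul_T, AddMonoidAlgebra.coeff_single, Finsupp.single_apply]

/-- **The derivative `d/dT` of Laurent polynomials**, `Σ aₙ Tⁿ ↦ Σ n aₙ Tⁿ⁻¹`, as a `K`-linear
map (coefficientwise: the coefficient of `T^m` in `f′` is `(m + 1) a_{m+1}`). [folklore] -/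
def laurentDeriv : K[T;T⁻¹] →ₗ[K] K[T;T⁻¹] where
  toFun f := AddMonoidAlgebra.ofCoeff
    (Finsupp.onFinset (f.coeff.support.image fun n => n - 1)
      (fun m => ((m + 1 : ℤ) : K) * f.coeff (m + 1)) (by
        intro m hm
        rw [Finset.mem_image]
        refine ⟨m + 1, Finsupp.mem_support_iff.mpr ?_, add_sub_cancel_right m 1⟩
        intro h
        exact hm (by rw [h, mul_zero])))
  map_add' f g := by
    ext m
    simp only [AddMonoidAlgebra.coeff_add, Finsupp.add_apply, Finsupp.onFinset_apply]
    ring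
  map_smul' c f := by
    ext m
    simp only [AddMonoidAlgebra.coeff_smul, Finsupp.smul_apply, Finsupp.onFinset_apply, smul_eq_mul,
      RingHom.id_apply]
    ring

/-- The coefficients of `f′`. [folklore] -/
@[simp]
theorem coeff_laurentDeriv (f : K[T;T⁻¹]) (m : ℤ) :
    (laurentDeriv K f).coeff m = ((m + 1 : ℤ) : K) * f.coeff (m + 1) :=
  rfl

/-- `(a Tⁿ)′ = n a Tⁿ⁻¹`. [folklore] -/
theorem laurentDeriv_C_mul_T (a : K) (n : ℤ) :
    laurentDeriv K (LaurentPolynomial.C a * T n) = LaurentPolynomial.C ((n : K) * a) * T (n - 1) := by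
  ext m
  rw [coeff_laurentDeriv, coeff_C_mul_T, coeff_C_mul_T]
  by_cases h : n = m + 1
  · subst h
    rw [if_pos rfl, if_pos (add_sub_cancel_right m 1)]
  · rw [if_neg h, if_neg (by omega), mul_zero]

/-- `(a)′ = 0`. [folklore] -/
@[simp]
theorem laurentDeriv_C (a : K) : laurentDeriv K (LaurentPolynomial.C a) = 0 := by
  have h := laurentDeriv_C_mul_T K a 0
  rwa [T_zero, mul_one, Int.cast_zero, zero_mul, map_zero, zero_mul] at h

/-- **Leibniz rule against a monomial**: `(f Tⁿ)′ = f′ Tⁿ + n f Tⁿ⁻¹`. [folklore] -/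
theorem laurentDeriv_mul_T (f : K[T;T⁻¹]) (n : ℤ) :
    laurentDeriv K (f * T n) =
      laurentDeriv K f * T n + LaurentPolynomial.C (n : K) * f * T (n - 1) := by
  induction f using LaurentPolynomial.induction_on' with
  | add p q hp hq => rw [add_mul, map_add, hp, hq, map_add]; ring
  | C_mul_T m a =>
    rw [mul_assoc, ← T_add, laurentDeriv_C_mul_T, laurentDeriv_C_mul_T]
    have h1 : LaurentPolynomial.C ((m : K) * a) * T (m - 1) * T n =
        LaurentPolynomial.C ((m : K) * a) * (T (m + n - 1) : K[T;T⁻¹]) := by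
      rw [mul_assoc, ← T_add, show m - 1 + n = m + n - 1 by ring]
    have h2 : LaurentPolynomial.C (n : K) * (LaurentPolynomial.C a * T m) * T (n - 1) =
        LaurentPolynomial.C ((n : K) * a) * (T (m + n - 1) : K[T;T⁻¹]) := by
      rw [map_mul, mul_assoc, mul_assoc, ← T_add, show m + (n - 1) = m + n - 1 by ring, ← mul_assoc]
    rw [h1, h2, ← add_mul, ← map_add, Int.cast_add, add_mul]

/-- **The residue** `Res_{T = 0} : K[T; T⁻¹] → K`, the coefficient of `T⁻¹`. [folklore] -/
def laurentRes : K[T;T⁻¹] →ₗ[K] K where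
  toFun f := f.coeff (-1)
  map_add' f g := by simp [AddMonoidAlgebra.coeff_add]
  map_smul' c f := by simp [AddMonoidAlgebra.coeff_smul]

/-- `Res f = a₋₁`. [folklore] -/
@[simp]
theorem laurentRes_apply (f : K[T;T⁻¹]) : laurentRes K f = f.coeff (-1) :=
  rfl

/-- **`Res (f′) = 0`**: derivatives have no `T⁻¹`-term. [folklore] -/
@[simp]
theorem laurentRes_laurentDeriv (f : K[T;T⁻¹]) : laurentRes K (laurentDeriv K f) = 0 := by
  simp

/-- `Res (T⁻¹) = 1`. [folklore] -/
theorem laurentRes_T_neg_one : laurentRes K (T (-1)) = 1 := by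
  simp

variable [CharZero K]

/-- **`ker (d/dT) = K`** in characteristic `0`: a Laurent polynomial with zero derivative is
constant. [folklore] -/
theorem eq_C_of_laurentDeriv_eq_zero {f : K[T;T⁻¹]} (h : laurentDeriv K f = 0) :
    f = LaurentPolynomial.C (f.coeff 0) := by
  ext m
  rw [LaurentPolynomial.C_apply]
  by_cases hm : m = 0
  · subst hm
    rw [if_pos rfl]
  · rw [if_neg hm]
    have h' := congrArg (fun g : K[T;T⁻¹] => g.coeff (m - 1)) h
    simp only [coeff_laurentDeriv, sub_add_cancel, AddMonoidAlgebra.coeff_zero,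
      Finsupp.zero_apply, mul_eq_zero, Int.cast_eq_zero] at h'
    exact h'.resolve_left hm

/-- **`im (d/dT) = ker Res`** in characteristic `0`: a Laurent polynomial without `T⁻¹`-term has a
primitive, `Σ_{n ≠ -1} aₙ Tⁿ = (Σ_{n ≠ -1} aₙ Tⁿ⁺¹/(n+1))′`. [folklore] -/
theorem exists_laurentDeriv_eq {g : K[T;T⁻¹]} (hg : g.coeff (-1) = 0) :
    ∃ F, laurentDeriv K F = g := by
  refine ⟨AddMonoidAlgebra.ofCoeff (Finsupp.onFinset (g.coeff.support.image (· + 1))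
    (fun n => ((n : ℤ) : K)⁻¹ * g.coeff (n - 1)) ?_), ?_⟩
  · intro n hn
    rw [Finset.mem_image]
    refine ⟨n - 1, Finsupp.mem_support_iff.mpr ?_, sub_add_cancel n 1⟩
    intro h
    exact hn (by rw [h, mul_zero])
  · ext m
    rw [coeff_laurentDeriv, AddMonoidAlgebra.coeff_ofCoeff, Finsupp.onFinset_apply,
      add_sub_cancel_right]
    by_cases hm : m = -1
    · subst hm
      rw [hg]
      simp
    · rw [← mul_assoc, mul_inv_cancel₀ (by exact_mod_cast (show m + 1 ≠ 0 by omega)), one_mul]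

end Gm

/-! ### Polynomial `1`-forms: coefficients and the differentials `dxᵢ` -/

section OneForms

variable {k : Type*} [CommRing k] {n : ℕ}

/-- Notation (local): `𝖽⟮f⟯` is the differential `df = extDeriv (ofPoly f)` of a polynomial. -/
local notation:max "𝖽⟮" f "⟯" => extDeriv (ofPoly f)

/-- The coefficient of `dxᵢ` in a polynomial `1`-form `ω` on `𝔸ⁿ`: the value `ω(eᵢ)`. [folklore] -/
def oneFormCoeff (i : Fin n) (ω : PolyForm k n 1) : MvPolynomial (Fin n) k :=
  ω fun _ => Pi.single i 1

/-- The coefficient of `dxᵢ` in `df` is `∂f/∂xᵢ`. [folklore] -/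
theorem oneFormCoeff_extDeriv_ofPoly (i : Fin n) (f : MvPolynomial (Fin n) k) :
    oneFormCoeff i 𝖽⟮f⟯ = pderiv i f := by
  rw [oneFormCoeff, extDeriv_ofPoly_apply, dirDeriv_single]

/-- `df ∧ g = g df` for a polynomial (`0`-form) `g`. [folklore] -/
theorem dWedge_ofPoly (f g : MvPolynomial (Fin n) k) : dWedge f (ofPoly g) = g • 𝖽⟮f⟯ := by
  refine AlternatingMap.ext fun v => ?_
  rw [dWedge_apply, AlternatingMap.smul_apply, extDeriv_ofPoly_apply, Fin.sum_univ_one]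
  simp [mul_comm]

/-- **Leibniz rule in degree `0`**: `d(fg) = g df + f dg`. [folklore] -/
theorem extDeriv_ofPoly_mul (f g : MvPolynomial (Fin n) k) : 𝖽⟮f * g⟯ = g • 𝖽⟮f⟯ + f • 𝖽⟮g⟯ := by
  rw [← smul_eq_mul, map_smul, extDeriv_smul, dWedge_ofPoly]

/-- `d(xᵢ^(m+1)) = (m + 1) xᵢ^m dxᵢ`. [folklore] -/
theorem extDeriv_ofPoly_X_pow (i : Fin n) (m : ℕ) :
    𝖽⟮(X i ^ (m + 1) : MvPolynomial (Fin n) k)⟯ =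
      ((m + 1 : ℕ) : MvPolynomial (Fin n) k) • ((X i ^ m : MvPolynomial (Fin n) k) • 𝖽⟮X i⟯) := by
  refine AlternatingMap.ext fun v => ?_
  simp only [extDeriv_ofPoly_apply, Derivation.leibniz_pow, AlternatingMap.smul_apply, smul_eq_mul,
    nsmul_eq_mul, Nat.add_sub_cancel]

/-- **A polynomial `1`-form is `Σᵢ ω(eᵢ) dxᵢ`.** [folklore] -/
theorem eq_sum_oneFormCoeff_smul (ω : PolyForm k n 1) :
    ω = ∑ i : Fin n, oneFormCoeff i ω • 𝖽⟮(X i : MvPolynomial (Fin n) k)⟯ := by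
  have h := sum_dWedge_X_curryLeft ω
  rw [show (0 + 1 : ℕ) • ω = ω from one_smul ℕ ω] at h
  conv_lhs => rw [← h]
  refine Finset.sum_congr rfl fun i _ => ?_
  have hc : ω.curryLeft (Pi.single i 1) = ofPoly (oneFormCoeff i ω) := by
    refine AlternatingMap.ext fun v => ?_
    rw [AlternatingMap.curryLeft_apply_apply, ofPoly_apply, oneFormCoeff]
    congr 1
    funext j
    fin_cases j
    rfl
  rw [hc, dWedge_ofPoly]

/-- `df ∧ df = 0`. [folklore] -/
theorem dWedge_extDeriv_ofPoly_self (f : MvPolynomial (Fin n) k) : dWedge f 𝖽⟮f⟯ = 0 := by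
  refine AlternatingMap.ext fun v => ?_
  simp only [dWedge_apply, extDeriv_ofPoly_apply, AlternatingMap.zero_apply]
  simp [Fin.removeNth]
  ring

/-- `df ∧ dg = −dg ∧ df`. [folklore] -/
theorem dWedge_extDeriv_ofPoly_comm (f g : MvPolynomial (Fin n) k) :
    dWedge f 𝖽⟮g⟯ = -dWedge g 𝖽⟮f⟯ := by
  have hf : 𝖽⟮f⟯ = dWedge f (ofPoly 1) := by rw [dWedge_ofPoly, one_smul]
  have hg : 𝖽⟮g⟯ = dWedge g (ofPoly 1) := by rw [dWedge_ofPoly, one_smul]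
  rw [hf, hg, dWedge_dWedge]

/-- `d(f − 1) ∧ ω = df ∧ ω`. [folklore] -/
theorem dWedge_sub_one (f : MvPolynomial (Fin n) k) {p : ℕ} (ω : PolyForm k n p) :
    dWedge (f - 1) ω = dWedge f ω := by
  refine AlternatingMap.ext fun v => ?_
  simp [dWedge_apply]

end OneForms

namespace Gm

/-! ### Restricting polynomial `1`-forms to `𝔾_m` -/

local notation:max "𝖽⟮" f "⟯" => extDeriv (ofPoly f)

/-- Notation (local): `P2 K = K[x, y]`. -/
local notation "P2" K:max => MvPolynomial (Fin 2) K

variable (K : Type*) [Field K]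

/-- **Restriction of a polynomial `1`-form to `𝔾_m`**, written in the basis `dT` of
`Ω¹_{K[T;T⁻¹]/K}`: `ω = g dx + h dy ↦ g(T, T⁻¹) − T⁻² h(T, T⁻¹)` (as `x = T`, `y = T⁻¹`,
`dx = dT`, `dy = −T⁻² dT`). A `K`-linear map `Ω¹_{K[x,y]/K} → K[T;T⁻¹]`. [folklore] -/
def gmRestrict : PolyForm K 2 1 →ₗ[K] K[T;T⁻¹] where
  toFun ω := gmParam K (oneFormCoeff 0 ω) - T (-2) * gmParam K (oneFormCoeff 1 ω)
  map_add' ω₁ ω₂ := by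
    simp only [oneFormCoeff, AlternatingMap.add_apply, map_add]
    ring
  map_smul' c ω := by
    simp only [oneFormCoeff, AlternatingMap.smul_apply, map_smul, RingHom.id_apply, smul_sub,
      mul_smul_comm]

/-- The defining formula of `gmRestrict`. [folklore] -/
theorem gmRestrict_apply (ω : PolyForm K 2 1) :
    gmRestrict K ω = gmParam K (oneFormCoeff 0 ω) - T (-2) * gmParam K (oneFormCoeff 1 ω) :=
  rfl

/-- `(f ω)|_{𝔾_m} = f(T, T⁻¹) ω|_{𝔾_m}`. [folklore] -/
theorem gmRestrict_smul (f : P2 K) (ω : PolyForm K 2 1) :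
    gmRestrict K (f • ω) = gmParam K f * gmRestrict K ω := by
  simp only [gmRestrict_apply, oneFormCoeff, AlternatingMap.smul_apply, smul_eq_mul, map_mul]
  ring

/-- **The chain rule** `d/dT f(T, T⁻¹) = (∂f/∂x)(T, T⁻¹) − T⁻² (∂f/∂y)(T, T⁻¹)`. [folklore] -/
theorem laurentDeriv_gmParam (f : P2 K) :
    laurentDeriv K (gmParam K f) = gmParam K (pderiv 0 f) - T (-2) * gmParam K (pderiv 1 f) := by
  have h01 : (0 : Fin 2) ≠ 1 := by decide
  have h10 : (1 : Fin 2) ≠ 0 := by decide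
  induction f using MvPolynomial.induction_on with
  | C a => simp
  | add p q hp hq =>
    simp only [map_add, hp, hq]
    ring
  | mul_X p i hp =>
    fin_cases i
    · simp only [Fin.zero_eta, Fin.isValue, map_mul, gmParam_X_zero, laurentDeriv_mul_T,
        Int.cast_one, map_one, one_mul, sub_self, T_zero, mul_one, Derivation.leibniz,
        pderiv_X_self, smul_eq_mul, pderiv_X_of_ne h01, mul_zero, zero_add, map_add]
      linear_combination (T 1 : K[T;T⁻¹]) * hp
    · simp only [Fin.mk_one, Fin.isValue, map_mul, gmParam_X_one, laurentDeriv_mul_T,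
        Int.reduceNeg, Int.cast_neg, Int.cast_one, map_neg, map_one, Int.reduceSub,
        Derivation.leibniz, pderiv_X_of_ne h10, smul_eq_mul, mul_zero, zero_add, pderiv_X_self,
        mul_one, map_add]
      have hT : (T (-2) : K[T;T⁻¹]) * T (-1) = T (-1) * T (-2) := mul_comm _ _
      linear_combination (T (-1) : K[T;T⁻¹]) * hp + gmParam K ((pderiv 1) p) * hT

/-- **`(df)|_{𝔾_m} = (d/dT) f(T, T⁻¹)`**: restriction commutes with `d`. [folklore] -/
theorem gmRestrict_extDeriv_ofPoly (f : P2 K) : gmRestrict K 𝖽⟮f⟯ = laurentDeriv K (gmParam K f) := by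
  rw [gmRestrict_apply, oneFormCoeff_extDeriv_ofPoly, oneFormCoeff_extDeriv_ofPoly,
    laurentDeriv_gmParam]

/-- `dx|_{𝔾_m} = dT`, i.e. coefficient `1`. [folklore] -/
theorem gmRestrict_dX_zero : gmRestrict K 𝖽⟮(X 0 : P2 K)⟯ = 1 := by
  rw [gmRestrict_extDeriv_ofPoly, gmParam_X_zero,
    show (T 1 : K[T;T⁻¹]) = LaurentPolynomial.C 1 * T 1 by rw [map_one, one_mul],
    laurentDeriv_C_mul_T]
  simp [T_zero]

/-- `(y dx)|_{𝔾_m} = T⁻¹ dT`. [folklore] -/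
theorem gmRestrict_ydx : gmRestrict K ((X 1 : P2 K) • 𝖽⟮(X 0 : P2 K)⟯) = T (-1) := by
  rw [gmRestrict_smul, gmRestrict_dX_zero, mul_one, gmParam_X_one]

/-- **Forms vanishing on `𝔾_m` restrict to zero**: `gmRestrict` kills
`I Ω¹ + K[x,y] dI`, `I = (xy − 1)`. [folklore] -/
theorem gmRestrict_eq_zero_of_mem {ω : PolyForm K 2 1} (h : ω ∈ vanishingForms (gmIdeal K) 1) :
    gmRestrict K ω = 0 := by
  let N : Submodule (P2 K) (PolyForm K 2 1) :=
    { carrier := {ω | gmRestrict K ω = 0}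
      add_mem' := fun {a b} ha hb => by
        simp only [Set.mem_setOf_eq, map_add] at ha hb ⊢
        rw [ha, hb, add_zero]
      zero_mem' := by simp
      smul_mem' := fun f ω hω => by
        simp only [Set.mem_setOf_eq] at hω ⊢
        rw [gmRestrict_smul, hω, mul_zero] }
  suffices hle : vanishingForms (gmIdeal K) 1 ≤ N from hle h
  change vanishingForms (gmIdeal K) (0 + 1) ≤ N
  rw [vanishingForms_succ]
  refine sup_le (Submodule.smul_le.mpr fun f hf ω _ => ?_) (Submodule.span_le.mpr ?_)
  · change gmRestrict K (f • ω) = 0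
    rw [gmRestrict_smul, gmParam_eq_zero_of_mem K hf, zero_mul]
  · rintro _ ⟨f, hf, η, rfl⟩
    change gmRestrict K (dWedge f η) = 0
    obtain ⟨g, rfl⟩ := (ofPoly (k := K) (n := 2)).surjective η
    rw [dWedge_ofPoly, gmRestrict_smul, gmRestrict_extDeriv_ofPoly, (gmParam_eq_zero_iff K).mpr hf,
      map_zero, mul_zero]

/-! ### Every `1`-form is a multiple of `y dx = dT/T` modulo forms exact on `𝔾_m` -/

/-- The `K`-subspace of polynomial `1`-forms on `𝔸²` that are **exact on `𝔾_m`**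
(`ω − dη ∈ I Ω¹ + K[x,y] dI` for a polynomial `η`). [folklore] -/
def exactOn : Submodule K (PolyForm K 2 1) :=
  (exactForms (gmIdeal K) 1).comap ((RegularForm.mk (gmIdeal K) (p := 1)).restrictScalars K)

/-- Membership in `exactOn` is `IsExactOn`. [folklore] -/
theorem mem_exactOn_iff {ω : PolyForm K 2 1} : ω ∈ exactOn K ↔ IsExactOn (gmIdeal K) ω := by
  rw [exactOn, Submodule.mem_comap, LinearMap.restrictScalars_apply, mk_mem_exactForms_iff]

/-- Forms vanishing on `𝔾_m` are exact on `𝔾_m`. [folklore] -/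
theorem mem_exactOn_of_mem_vanishingForms {ω : PolyForm K 2 1}
    (h : ω ∈ vanishingForms (gmIdeal K) 1) : ω ∈ exactOn K := by
  rw [mem_exactOn_iff, isExactOn_succ_iff]
  exact ⟨0, by rwa [extDeriv_zero, sub_zero]⟩

/-- Differentials of polynomials are exact on `𝔾_m`. [folklore] -/
theorem extDeriv_ofPoly_mem_exactOn (f : P2 K) : 𝖽⟮f⟯ ∈ exactOn K := by
  rw [mem_exactOn_iff, isExactOn_succ_iff]
  exact ⟨ofPoly f, by rw [sub_self]; exact Submodule.zero_mem _⟩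

/-- **The residue of a form exact on `𝔾_m` vanishes.** [folklore] -/
theorem laurentRes_gmRestrict_eq_zero_of_mem_exactOn {ω : PolyForm K 2 1} (h : ω ∈ exactOn K) :
    laurentRes K (gmRestrict K ω) = 0 := by
  rw [mem_exactOn_iff, isExactOn_succ_iff] at h
  obtain ⟨η, hη⟩ := h
  obtain ⟨f, rfl⟩ := (ofPoly (k := K) (n := 2)).surjective η
  rw [← sub_add_cancel ω 𝖽⟮f⟯, map_add, gmRestrict_eq_zero_of_mem K hη, zero_add,
    gmRestrict_extDeriv_ofPoly, laurentRes_laurentDeriv]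

/-- `d(xy − 1) = y dx + x dy`. [folklore] -/
theorem extDeriv_ofPoly_eqn :
    𝖽⟮(X 0 * X 1 - 1 : P2 K)⟯ = (X 1 : P2 K) • 𝖽⟮(X 0 : P2 K)⟯ + (X 0 : P2 K) • 𝖽⟮(X 1 : P2 K)⟯ := by
  have h : 𝖽⟮(X 0 * X 1 - 1 : P2 K)⟯ = 𝖽⟮(X 0 * X 1 : P2 K)⟯ - 𝖽⟮(1 : P2 K)⟯ := by
    rw [map_sub]
    exact map_sub (extDerivₗ K 2 0) _ _
  rw [h, ← C_1, extDeriv_ofPoly_C, sub_zero, extDeriv_ofPoly_mul]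

/-- **`f dy ≡ −f y² dx` modulo forms vanishing on `𝔾_m`** (`dy = −y² dx` on `xy = 1`). [folklore] -/
theorem smul_dX_one_add_mem (f : P2 K) :
    f • 𝖽⟮(X 1 : P2 K)⟯ + (f * X 1 ^ 2) • 𝖽⟮(X 0 : P2 K)⟯ ∈ vanishingForms (gmIdeal K) 1 := by
  have h1 : 𝖽⟮(X 0 * X 1 - 1 : P2 K)⟯ ∈ vanishingForms (gmIdeal K) (0 + 1) :=
    extDeriv_mem_vanishingForms _ ((ofPoly_mem_vanishingForms_iff _ _).mpr (eqn_mem_gmIdeal K))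
  have key : f • 𝖽⟮(X 1 : P2 K)⟯ + (f * X 1 ^ 2) • 𝖽⟮(X 0 : P2 K)⟯ =
      (f * X 1) • 𝖽⟮(X 0 * X 1 - 1 : P2 K)⟯ + (-(f * (X 0 * X 1 - 1))) • 𝖽⟮(X 1 : P2 K)⟯ := by
    rw [extDeriv_ofPoly_eqn]
    module
  rw [key]
  exact Submodule.add_mem _ (Submodule.smul_mem _ _ h1)
    (smul_mem_vanishingForms _ (Submodule.neg_mem _ (Ideal.mul_mem_left _ _ (eqn_mem_gmIdeal K))) _)

variable [CharZero K]

/-- **The monomial forms `xᵃ yᵇ dx` modulo exact forms**: each is a `K`-multiple of `y dx`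
modulo forms exact on `𝔾_m` — `xᵃ dx = d(xᵃ⁺¹/(a+1))`, `y^{m+2} dx ≡ d(y^{m+1})/(−(m+1))`,
`x^{a+1} y^{b+1} dx ≡ xᵃ yᵇ dx`. [cite: Hartshorne1975, Ch. II §7 p. 53] -/
theorem pow_smul_dX_mem (a b : ℕ) :
    (X 0 ^ a * X 1 ^ b : P2 K) • 𝖽⟮(X 0 : P2 K)⟯ ∈
      exactOn K ⊔ K ∙ ((X 1 : P2 K) • 𝖽⟮(X 0 : P2 K)⟯) := by
  induction a generalizing b with
  | zero =>
    rcases b with _ | _ | m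
    · rw [pow_zero, pow_zero, one_mul, one_smul]
      exact Submodule.mem_sup_left (extDeriv_ofPoly_mem_exactOn K _)
    · rw [pow_zero, pow_one, one_mul]
      exact Submodule.mem_sup_right (Submodule.mem_span_singleton_self _)
    · have hv := smul_dX_one_add_mem K (X 1 ^ m)
      have hd := extDeriv_ofPoly_X_pow (k := K) (n := 2) 1 m
      have h3 : ((m + 1 : ℕ) : P2 K) • ((X 1 ^ m : P2 K) • 𝖽⟮(X 1 : P2 K)⟯ +
          (X 1 ^ m * X 1 ^ 2 : P2 K) • 𝖽⟮(X 0 : P2 K)⟯) - 𝖽⟮(X 1 ^ (m + 1) : P2 K)⟯ ∈ exactOn K :=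
        Submodule.sub_mem _ (mem_exactOn_of_mem_vanishingForms K (Submodule.smul_mem _ _ hv))
          (extDeriv_ofPoly_mem_exactOn K _)
      rw [hd, smul_add, add_sub_cancel_left, Nat.cast_smul_eq_nsmul (P2 K), ← Nat.cast_smul_eq_nsmul K,
        Submodule.smul_mem_iff _ (by exact_mod_cast Nat.succ_ne_zero m)] at h3
      rw [pow_zero, one_mul, show (X 1 ^ (m + 2) : P2 K) = X 1 ^ m * X 1 ^ 2 by ring]
      exact Submodule.mem_sup_left h3
  | succ a ih =>
    rcases b with _ | b
    · have hd := extDeriv_ofPoly_X_pow (k := K) (n := 2) 0 (a + 1)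
      have h3 : 𝖽⟮(X 0 ^ (a + 1 + 1) : P2 K)⟯ ∈ exactOn K := extDeriv_ofPoly_mem_exactOn K _
      rw [hd, Nat.cast_smul_eq_nsmul (P2 K), ← Nat.cast_smul_eq_nsmul K,
        Submodule.smul_mem_iff _ (by exact_mod_cast Nat.succ_ne_zero (a + 1))] at h3
      rw [pow_zero, mul_one]
      exact Submodule.mem_sup_left h3
    · have hsplit : (X 0 ^ (a + 1) * X 1 ^ (b + 1) : P2 K) =
          X 0 ^ a * X 1 ^ b + X 0 ^ a * X 1 ^ b * (X 0 * X 1 - 1) := by ring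
      rw [hsplit, add_smul]
      exact Submodule.add_mem _ (ih b) (Submodule.mem_sup_left (mem_exactOn_of_mem_vanishingForms K
        (smul_mem_vanishingForms _ (Ideal.mul_mem_left _ _ (eqn_mem_gmIdeal K)) _)))

/-- **Every polynomial `1`-form on `𝔸²` is a `K`-multiple of `y dx` modulo forms exact on `𝔾_m`.**
[cite: Hartshorne1975, Ch. II §7 p. 53] -/
theorem exactOn_sup_span_eq_top : exactOn K ⊔ K ∙ ((X 1 : P2 K) • 𝖽⟮(X 0 : P2 K)⟯) = ⊤ := by
  rw [eq_top_iff]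
  rintro ω -
  have hf : ∀ f : P2 K, f • 𝖽⟮(X 0 : P2 K)⟯ ∈ exactOn K ⊔ K ∙ ((X 1 : P2 K) • 𝖽⟮(X 0 : P2 K)⟯) := by
    intro f
    induction f using MvPolynomial.induction_on' with
    | monomial u a =>
      rw [show monomial u a = a • (X 0 ^ (u 0) * X 1 ^ (u 1) : P2 K) by
        rw [MvPolynomial.monomial_eq, Finsupp.prod_fintype _ _ (fun i => pow_zero _), Fin.prod_univ_two,
          MvPolynomial.smul_eq_C_mul], smul_assoc]
      exact Submodule.smul_mem _ a (pow_smul_dX_mem K (u 0) (u 1))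
    | add p q hp hq =>
      rw [add_smul]
      exact Submodule.add_mem _ hp hq
  rw [eq_sum_oneFormCoeff_smul ω, Fin.sum_univ_two]
  refine Submodule.add_mem _ (hf _) ?_
  rw [← add_sub_cancel_right (oneFormCoeff 1 ω • 𝖽⟮(X 1 : P2 K)⟯)
    ((oneFormCoeff 1 ω * X 1 ^ 2) • 𝖽⟮(X 0 : P2 K)⟯)]
  exact Submodule.sub_mem _
    (Submodule.mem_sup_left (mem_exactOn_of_mem_vanishingForms K (smul_dX_one_add_mem K _))) (hf _)

/-- **Normal form of `1`-forms on `𝔾_m`**: for every polynomial `1`-form `ω` there is a constant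
`c` with `ω − c · y dx` exact on `𝔾_m` (`c` is the residue of `ω|_{𝔾_m}` at `T = 0`).
[cite: Hartshorne1975, Ch. II §7 p. 53] -/
theorem exists_isExactOn_sub_smul_ydx (ω : PolyForm K 2 1) :
    ∃ c : K, IsExactOn (gmIdeal K) (ω - c • ((X 1 : P2 K) • 𝖽⟮(X 0 : P2 K)⟯)) := by
  have h : ω ∈ exactOn K ⊔ K ∙ ((X 1 : P2 K) • 𝖽⟮(X 0 : P2 K)⟯) := by
    rw [exactOn_sup_span_eq_top]
    exact Submodule.mem_top
  obtain ⟨e, he, z, hz, rfl⟩ := Submodule.mem_sup.mp h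
  obtain ⟨c, rfl⟩ := Submodule.mem_span_singleton.mp hz
  exact ⟨c, by rwa [add_sub_cancel_right, ← mem_exactOn_iff]⟩

/-! ### `Ω²_{𝔾_m} = 0`: every `2`-form vanishes on `𝔾_m` -/

omit [CharZero K] in
/-- `dy ∧ β ≡ −y² dx ∧ β` modulo forms vanishing on `𝔾_m`. [folklore] -/
theorem dWedge_X_one_add_mem {p : ℕ} (β : PolyForm K 2 p) :
    dWedge (X 1 : P2 K) β + (X 1 ^ 2 : P2 K) • dWedge (X 0 : P2 K) β ∈
      vanishingForms (gmIdeal K) (p + 1) := by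
  have h1 : dWedge (X 0 * X 1 - 1 : P2 K) β ∈ vanishingForms (gmIdeal K) (p + 1) :=
    dWedge_mem_vanishingForms _ (eqn_mem_gmIdeal K) β
  rw [dWedge_sub_one, dWedge_mul] at h1
  have key : dWedge (X 1 : P2 K) β + (X 1 ^ 2 : P2 K) • dWedge (X 0 : P2 K) β =
      (X 1 : P2 K) • ((X 0 : P2 K) • dWedge (X 1 : P2 K) β + (X 1 : P2 K) • dWedge (X 0 : P2 K) β) +
        (-(X 0 * X 1 - 1 : P2 K)) • dWedge (X 1 : P2 K) β := by
    rw [smul_add, smul_smul, smul_smul, add_right_comm, ← add_smul, ← pow_two, neg_sub,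
      mul_comm (X 1 : P2 K) (X 0), add_sub_cancel, one_smul]
  rw [key]
  exact Submodule.add_mem _ (Submodule.smul_mem _ _ h1)
    (smul_mem_vanishingForms _ (Submodule.neg_mem _ (eqn_mem_gmIdeal K)) _)

omit [CharZero K] in
/-- `dx ∧ γ` vanishes on `𝔾_m` for every polynomial `1`-form `γ` (`dx ∧ dx = 0`,
`dx ∧ dy ≡ y² dx ∧ dx = 0`). [folklore] -/
theorem dWedge_X_zero_mem (γ : PolyForm K 2 1) :
    dWedge (X 0 : P2 K) γ ∈ vanishingForms (gmIdeal K) 2 := by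
  have h1 : dWedge (X 1 : P2 K) 𝖽⟮(X 0 : P2 K)⟯ ∈ vanishingForms (gmIdeal K) 2 := by
    have h := dWedge_X_one_add_mem K 𝖽⟮(X 0 : P2 K)⟯
    rwa [dWedge_extDeriv_ofPoly_self, smul_zero, add_zero] at h
  rw [eq_sum_oneFormCoeff_smul γ, Fin.sum_univ_two, dWedge_add, dWedge_smul_right,
    dWedge_smul_right, dWedge_extDeriv_ofPoly_self, smul_zero, zero_add,
    dWedge_extDeriv_ofPoly_comm, smul_neg]
  exact Submodule.neg_mem _ (Submodule.smul_mem _ _ h1)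

/-- **`Ω²_{𝔾_m} = 0`**: every polynomial `2`-form on `𝔸²` vanishes on the curve `𝔾_m`
(`2η = dx ∧ ι₀η + dy ∧ ι₁η`, and `dy ≡ −y² dx`). [folklore] -/
theorem vanishingForms_two_eq_top : vanishingForms (gmIdeal K) 2 = ⊤ := by
  rw [eq_top_iff]
  rintro η -
  have h := sum_dWedge_X_curryLeft η
  rw [Fin.sum_univ_two] at h
  have h2 : (1 + 1) • η ∈ vanishingForms (gmIdeal K) (1 + 1) := by
    rw [← h, ← add_sub_cancel_right (dWedge (X 1 : P2 K) (η.curryLeft (Pi.single 1 1)))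
      ((X 1 ^ 2 : P2 K) • dWedge (X 0 : P2 K) (η.curryLeft (Pi.single 1 1)))]
    exact Submodule.add_mem _ (dWedge_X_zero_mem K _) (Submodule.sub_mem _
      (dWedge_X_one_add_mem K _) (Submodule.smul_mem _ _ (dWedge_X_zero_mem K _)))
  rwa [← Nat.cast_smul_eq_nsmul K, Submodule.smul_mem_iff _ (by norm_num)] at h2

/-- Hence every polynomial `1`-form is closed on `𝔾_m`: `Z¹ = Ω¹_{𝔾_m}`. [folklore] -/
theorem closedForms_one_eq_top : closedForms (gmIdeal K) 1 = ⊤ := by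
  rw [eq_top_iff]
  rintro x -
  obtain ⟨ω, rfl⟩ := RegularForm.mk_surjective _ x
  rw [mk_mem_closedForms_iff, IsClosedOn]
  change extDeriv ω ∈ vanishingForms (gmIdeal K) 2
  rw [vanishingForms_two_eq_top]
  exact Submodule.mem_top

/-- There are no non-zero regular `2`-forms on `𝔾_m`. [folklore] -/
theorem subsingleton_regularForm_two : Subsingleton (RegularForm (gmIdeal K) 2) :=
  Submodule.Quotient.subsingleton_iff.mpr (vanishingForms_two_eq_top K)

/-- **`H²_dR(𝔾_m) = 0`.** [cite: Hartshorne1975, Ch. II §7 p. 53] -/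
theorem subsingleton_deRhamCohomology_two : Subsingleton (DeRhamCohomology (gmIdeal K) 2) := by
  haveI := subsingleton_regularForm_two K
  refine subsingleton_of_forall_eq 0 fun x => ?_
  obtain ⟨c, rfl⟩ := DeRhamCohomology.mk_surjective _ x
  rw [Subsingleton.elim c 0, map_zero]

/-- **`H^p_dR(𝔾_m) = 0` for `p ≥ 2`.** [cite: Hartshorne1975, Ch. II §7 p. 53] -/
theorem subsingleton_deRhamCohomology_add_two (p : ℕ) :
    Subsingleton (DeRhamCohomology (gmIdeal K) (p + 2)) := by
  rcases p with _ | p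
  · exact subsingleton_deRhamCohomology_two K
  · exact subsingleton_deRhamCohomology_of_lt _ (by omega)

/-! ### `H¹_dR(𝔾_m) ≃ K` by the residue -/

omit [CharZero K] in
/-- The residue `Res_{T=0} (ω|_{𝔾_m})` of a regular `1`-form on `𝔾_m`, `Ω¹_{𝔾_m} → K`
(well defined: forms vanishing on `𝔾_m` restrict to `0`). [folklore] -/
def regularFormRes : RegularForm (gmIdeal K) 1 →ₗ[K] K :=
  ((vanishingForms (gmIdeal K) 1).restrictScalars K).liftQ (laurentRes K ∘ₗ gmRestrict K)
      (fun ω hω => by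
        simp only [LinearMap.mem_ker, LinearMap.comp_apply]
        rw [gmRestrict_eq_zero_of_mem K hω, map_zero]) ∘ₗ
    (Submodule.Quotient.restrictScalarsEquiv K (vanishingForms (gmIdeal K) 1)).symm.toLinearMap

omit [CharZero K] in
/-- `regularFormRes` on the restriction of a polynomial form. [folklore] -/
@[simp]
theorem regularFormRes_mk (ω : PolyForm K 2 1) :
    regularFormRes K (RegularForm.mk _ ω) = laurentRes K (gmRestrict K ω) :=
  rfl

/-- **The residue map `H¹_dR(𝔾_m) → K`** (exact forms have residue `0`). [folklore] -/
def cohomologyRes : DeRhamCohomology (gmIdeal K) 1 →ₗ[K] K :=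
  ((exactForms (gmIdeal K) 1).comap (closedForms (gmIdeal K) 1).subtype).liftQ
    (regularFormRes K ∘ₗ (closedForms (gmIdeal K) 1).subtype) (by
      rintro ⟨x, hx⟩ hx'
      rw [Submodule.mem_comap, Submodule.subtype_apply] at hx'
      obtain ⟨ω, rfl⟩ := RegularForm.mk_surjective _ x
      rw [mk_mem_exactForms_iff] at hx'
      rw [LinearMap.mem_ker, LinearMap.comp_apply, Submodule.subtype_apply, regularFormRes_mk]
      exact laurentRes_gmRestrict_eq_zero_of_mem_exactOn K ((mem_exactOn_iff K).mpr hx'))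

omit [CharZero K] in
/-- `cohomologyRes` of the class of a closed form. [folklore] -/
@[simp]
theorem cohomologyRes_mk (x : closedForms (gmIdeal K) 1) :
    cohomologyRes K (DeRhamCohomology.mk _ x) = regularFormRes K x :=
  rfl

/-- The residue map is onto: the class of `c · y dx` has residue `c`. [folklore] -/
theorem cohomologyRes_surjective : Function.Surjective (cohomologyRes K) := by
  intro c
  refine ⟨DeRhamCohomology.mk _ ⟨RegularForm.mk _ (c • ((X 1 : P2 K) • 𝖽⟮(X 0 : P2 K)⟯)),
    by rw [closedForms_one_eq_top]; exact Submodule.mem_top⟩, ?_⟩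
  rw [cohomologyRes_mk]
  change regularFormRes K (RegularForm.mk _ _) = c
  rw [regularFormRes_mk, map_smul, map_smul, gmRestrict_ydx, laurentRes_T_neg_one, smul_eq_mul, mul_one]

/-- The residue map is injective: a form with residue `0` is exact on `𝔾_m`. [folklore] -/
theorem cohomologyRes_injective : Function.Injective (cohomologyRes K) := by
  rw [injective_iff_map_eq_zero]
  intro z hz
  obtain ⟨⟨x, hx⟩, rfl⟩ := DeRhamCohomology.mk_surjective _ z
  obtain ⟨ω, rfl⟩ := RegularForm.mk_surjective _ x
  rw [cohomologyRes_mk] at hz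
  change laurentRes K (gmRestrict K ω) = 0 at hz
  obtain ⟨c, hc⟩ := exists_isExactOn_sub_smul_ydx K ω
  have hc0 : c = 0 := by
    have h1 := laurentRes_gmRestrict_eq_zero_of_mem_exactOn K ((mem_exactOn_iff K).mpr hc)
    rwa [map_sub, map_sub, hz, zero_sub, map_smul, map_smul, gmRestrict_ydx, laurentRes_T_neg_one,
      smul_eq_mul, mul_one, neg_eq_zero] at h1
  rw [hc0, zero_smul, sub_zero] at hc
  rw [DeRhamCohomology.mk_eq_zero_iff]
  exact (mk_mem_exactForms_iff _ ω).mpr hc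

/-- **`H¹_dR(𝔾_m/K) ≃ K`** by the residue at `T = 0` (`K` of characteristic `0`): the algebraic
de Rham `H¹` of `Spec K[t, t⁻¹]` is spanned by the class of `dt/t`.
[cite: Hartshorne1975, Ch. II §7 p. 53] -/
def deRhamCohomologyOneEquiv : DeRhamCohomology (gmIdeal K) 1 ≃ₗ[K] K :=
  LinearEquiv.ofBijective (cohomologyRes K) ⟨cohomologyRes_injective K, cohomologyRes_surjective K⟩

/-! ### `H⁰_dR(𝔾_m) ≃ K` -/

omit [CharZero K] in
/-- The constants as closed `0`-forms on `𝔾_m`, `K → Z⁰(𝔾_m)`. [folklore] -/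
def constClosedForm : K →ₗ[K] closedForms (gmIdeal K) 0 :=
  LinearMap.codRestrict _
    (((RegularForm.mk (gmIdeal K) (p := 0)).restrictScalars K) ∘ₗ
      ((ofPoly (k := K) (n := 2)).toLinearMap.restrictScalars K) ∘ₗ Algebra.linearMap K (P2 K))
    (fun c => by
      change RegularForm.mk _ (ofPoly (C c)) ∈ closedForms _ 0
      rw [mk_mem_closedForms_iff, IsClosedOn, extDeriv_ofPoly_C]
      exact Submodule.zero_mem _)

omit [CharZero K] in
/-- `constClosedForm K c` is the class of the `0`-form `C c`. [folklore] -/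
theorem coe_constClosedForm (c : K) :
    (constClosedForm K c : RegularForm (gmIdeal K) 0) = RegularForm.mk _ (ofPoly (C c)) :=
  rfl

/-- **The closed `0`-forms on `𝔾_m` are the constants**: `f ↦ f(T, T⁻¹)` has derivative
`(df)|_{𝔾_m} = 0`, hence is constant, hence `f ≡ c (mod xy − 1)`. [cite: Hartshorne1975, Ch. II §7 p. 53] -/
theorem constClosedForm_bijective : Function.Bijective (constClosedForm K) := by
  constructor
  · rw [injective_iff_map_eq_zero]
    intro c hc
    have h : RegularForm.mk (gmIdeal K) (ofPoly (C c)) = 0 := by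
      rw [← coe_constClosedForm, hc]; rfl
    rw [RegularForm.mk_eq_zero_iff, ofPoly_mem_vanishingForms_iff, ← gmParam_eq_zero_iff,
      gmParam_C] at h
    simpa using congrArg (fun g : K[T;T⁻¹] => g.coeff 0) h
  · rintro ⟨x, hx⟩
    obtain ⟨θ, rfl⟩ := RegularForm.mk_surjective _ x
    obtain ⟨f, rfl⟩ := (ofPoly (k := K) (n := 2)).surjective θ
    rw [mk_mem_closedForms_iff, IsClosedOn] at hx
    have h1 : laurentDeriv K (gmParam K f) = 0 := by
      rw [← gmRestrict_extDeriv_ofPoly]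
      exact gmRestrict_eq_zero_of_mem K hx
    have h2 := eq_C_of_laurentDeriv_eq_zero K h1
    refine ⟨(gmParam K f).coeff 0, Subtype.ext ?_⟩
    rw [coe_constClosedForm, RegularForm.mk_eq_mk_iff, ← map_sub, ofPoly_mem_vanishingForms_iff,
      ← gmParam_eq_zero_iff, map_sub, gmParam_C, ← h2, sub_self]

/-- `K ≃ Z⁰(𝔾_m)`. [folklore] -/
def closedFormsZeroEquiv : K ≃ₗ[K] closedForms (gmIdeal K) 0 :=
  LinearEquiv.ofBijective _ (constClosedForm_bijective K)

/-- **`H⁰_dR(𝔾_m/K) ≃ K`** (`K` of characteristic `0`): `H⁰ = Z⁰ = K`.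
[cite: Hartshorne1975, Ch. II §7 p. 53] -/
def deRhamCohomologyZeroEquiv : DeRhamCohomology (gmIdeal K) 0 ≃ₗ[K] K :=
  (Submodule.quotEquivOfEqBot _ (by
    change ((⊥ : Submodule K _).comap (closedForms (gmIdeal K) 0).subtype) = ⊥
    rw [Submodule.comap_bot, Submodule.ker_subtype]) :
      DeRhamCohomology (gmIdeal K) 0 ≃ₗ[K] closedForms (gmIdeal K) 0).trans
    (closedFormsZeroEquiv K).symm

/-! ### The complex points: `V(xy − 1)(ℂ) ≃ ℂ ∖ 0 ≃ S¹` -/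

section Complex

open Literature.AlgebraicTopology.SingularHomology CategoryTheory CategoryTheory.Limits

/-- The complex points of `𝔾_m`: `V(xy − 1)(ℂ) = {(x, y) | xy = 1}`. [folklore] -/
theorem mem_zeroLocus_gmIdeal_iff (v : Fin 2 → ℂ) :
    v ∈ MvPolynomial.zeroLocus ℂ (gmIdeal ℂ) ↔ v 0 * v 1 = 1 := by
  rw [gmIdeal, MvPolynomial.zeroLocus_span]
  simp [sub_eq_zero]

/-- **`V(xy − 1)(ℂ) ≃ₜ ℂ ∖ 0`**, `(x, y) ↦ x`, inverse `z ↦ (z, z⁻¹)`. [folklore] -/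
def zeroLocusHomeomorph : MvPolynomial.zeroLocus ℂ (gmIdeal ℂ) ≃ₜ {z : ℂ // z ≠ 0} where
  toFun v := ⟨v.1 0, fun h => by
    have h1 := (mem_zeroLocus_gmIdeal_iff v.1).mp v.2
    rw [h, zero_mul] at h1
    exact zero_ne_one h1⟩
  invFun z := ⟨fun i => if i = 0 then z.1 else z.1⁻¹, by
    rw [mem_zeroLocus_gmIdeal_iff]
    simp [z.2]⟩
  left_inv v := by
    have h := (mem_zeroLocus_gmIdeal_iff v.1).mp v.2
    refine Subtype.ext (funext fun i => ?_)
    fin_cases i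
    · rfl
    · change (if (1 : Fin 2) = 0 then v.1 0 else (v.1 0)⁻¹) = v.1 1
      rw [if_neg (by decide)]
      exact (eq_inv_of_mul_eq_one_right h).symm
  right_inv z := Subtype.ext (by simp)
  continuous_toFun := ((continuous_apply 0).comp continuous_subtype_val).subtype_mk _
  continuous_invFun := by
    refine Continuous.subtype_mk (continuous_pi fun i => ?_) _
    split_ifs
    · exact continuous_subtype_val
    · exact continuous_subtype_val.inv₀ fun z => z.2

/-- A real-linear homeomorphism `ℂ ≃ ℝ²`. [folklore] -/
def complexEquivRVec : ℂ ≃L[ℝ] RVec (1 + 1) :=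
  ContinuousLinearEquiv.ofFinrankEq (by rw [Complex.finrank_real_complex, Module.finrank_fin_fun])

/-- **`ℂ ∖ 0 ≃ₜ ℝ² ∖ 0`.** [folklore] -/
def puncturedComplexHomeomorph : {z : ℂ // z ≠ 0} ≃ₜ ↥(punctured (1 + 1)) :=
  complexEquivRVec.toHomeomorph.subtype fun z => by
    change z ≠ 0 ↔ complexEquivRVec z ∈ punctured (1 + 1)
    rw [mem_punctured, complexEquivRVec.toLinearEquiv.map_ne_zero_iff.symm]
    rfl

set_option quotPrecheck false in
/-- Notation (local): the unit circle `S¹ ⊆ ℝ²`. -/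
local notation "S¹" => ↥(unitSphere (1 + 1))

/-- The circle is path connected. [folklore] -/
theorem pathConnectedSpace_circle : PathConnectedSpace S¹ :=
  isPathConnected_iff_pathConnectedSpace.mp (isPathConnected_sphere (by
    have h : 1 < Module.finrank ℝ (EuclideanSpace ℝ (Fin (1 + 1))) := by
      rw [finrank_euclideanSpace_fin]; norm_num
    simpa using Module.lt_rank_of_lt_finrank h) (0 : EuclideanSpace ℝ (Fin (1 + 1))) zero_le_one)

/-- **`H⁰(S¹; ℂ) ≃ ℂ`** (path connected). [cite: HatcherAT2002, §3.1 p. 199] -/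
def circleCohomologyZeroEquiv : singularCohomology ℂ ℂ S¹ 0 ≃ₗ[ℂ] ℂ :=
  haveI := pathConnectedSpace_circle
  singularCohomologyZeroEquiv ℂ ℂ S¹

/-- **`dim_ℂ H¹(S¹; ℂ) = 1`**: universal coefficients over a field and `H₁(S¹; ℂ) ≅ ℂ`.
[cite: HatcherAT2002, Cor. 2.14 and Thm. 3.2] -/
theorem finrank_circleCohomology_one : Module.finrank ℂ (singularCohomology ℂ ℂ S¹ 1) = 1 := by
  rw [finrank_singularCohomology_eq_bettiNumber_of_field]
  exact ((singularHomologyUnitSphereIso ℂ ℂ 1 le_rfl).toLinearEquiv.finrank_eq).trans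
    (Module.finrank_self ℂ)

/-- **`H^p(S¹; ℂ) = 0` for `p ≥ 2`**: `H_p(S¹; ℂ) = 0` and `H^p ↪ Hom(H_p, ℂ)` over a field.
[cite: HatcherAT2002, Cor. 2.14 and Thm. 3.2] -/
theorem isZero_circleCohomology {p : ℕ} (hp : 2 ≤ p) : IsZero (singularCohomology ℂ ℂ S¹ p) := by
  have hz : IsZero (singularHomology ℂ ℂ S¹ p) :=
    isZero_singularHomology_sphere_holds ℂ ℂ (show p ≠ 0 by omega) (show p ≠ 1 by omega)
  haveI : Subsingleton (singularHomology ℂ ℂ S¹ p) := ModuleCat.subsingleton_of_isZero hz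
  have hinj := kroneckerPairing_injective_of_field ℂ S¹ p
  haveI : Subsingleton (singularCohomology ℂ ℂ S¹ p) := ⟨fun a b => hinj (Subsingleton.elim _ _)⟩
  exact ModuleCat.isZero_of_subsingleton _

/-- **`H^p(V(xy − 1)(ℂ); ℂ) ≅ H^p(S¹; ℂ)`**: `V(xy − 1)(ℂ) ≃ₜ ℂ ∖ 0 ≃ₜ ℝ² ∖ 0 ≃ S¹`
(homeomorphism and homotopy invariance of singular cohomology). [cite: HatcherAT2002, §3.1 p. 201] -/
def zeroLocusCohomologyIso (p : ℕ) :
    singularCohomology ℂ ℂ (MvPolynomial.zeroLocus ℂ (gmIdeal ℂ)) p ≅ singularCohomology ℂ ℂ S¹ p :=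
  (singularCohomology.mapIso ℂ ℂ zeroLocusHomeomorph p).symm ≪≫
    (singularCohomology.mapIso ℂ ℂ puncturedComplexHomeomorph p).symm ≪≫
      singularCohomology.isoOfHomotopyEquiv' ℂ ℂ (sphereHomotopyEquivPunctured (1 + 1)) p

/-- **`H¹(V(xy − 1)(ℂ); ℂ)` is one-dimensional.** [cite: HatcherAT2002, Cor. 2.14 and Thm. 3.2] -/
theorem finrank_zeroLocusCohomology_one :
    Module.finrank ℂ (singularCohomology ℂ ℂ (MvPolynomial.zeroLocus ℂ (gmIdeal ℂ)) 1) = 1 :=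
  ((zeroLocusCohomologyIso 1).toLinearEquiv.finrank_eq).trans finrank_circleCohomology_one

end Complex

end Gm

end AffineDeRham

/-! ### The comparison theorem for `𝔾_m` -/

namespace AffineAlgebraicDeRham

open AffineDeRham Literature.AlgebraicTopology.SingularHomology CategoryTheory

/-- **Grothendieck's comparison theorem for the multiplicative group** (the case
`I = (xy − 1) ⊆ ℂ[x, y]` of `AffineAlgebraicDeRham`, PROVED): for every `p`,
`H^p_dR(𝔾_m/ℂ) ≅ H^p(ℂˣ; ℂ)` as `ℂ`-vector spaces — both are `ℂ` for `p = 0, 1` (the class of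
`dt/t`, resp. of a generator of `H¹(S¹)`) and `0` for `p ≥ 2`. [Grothendieck1966, Thm 1;
Hartshorne1975, Ch. II §7 p. 53; Hatcher Cor. 2.14, Thm. 3.2.] [cite: Grothendieck1966, Thm 1] -/
theorem gm (p : ℕ) :
    Nonempty (DeRhamCohomology (Gm.gmIdeal ℂ) p ≃ₗ[ℂ]
      singularCohomology ℂ ℂ (MvPolynomial.zeroLocus ℂ (Gm.gmIdeal ℂ)) p) := by
  rcases p with _ | _ | p
  · exact ⟨(Gm.deRhamCohomologyZeroEquiv ℂ).trans
      (Gm.circleCohomologyZeroEquiv.symm.trans (Gm.zeroLocusCohomologyIso 0).toLinearEquiv.symm)⟩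
  · haveI : Module.Finite ℂ (singularCohomology ℂ ℂ (MvPolynomial.zeroLocus ℂ (Gm.gmIdeal ℂ)) 1) :=
      Module.finite_of_finrank_eq_succ Gm.finrank_zeroLocusCohomology_one
    have e : ℂ ≃ₗ[ℂ] singularCohomology ℂ ℂ (MvPolynomial.zeroLocus ℂ (Gm.gmIdeal ℂ)) 1 :=
      LinearEquiv.ofFinrankEq _ _ (by rw [Module.finrank_self, Gm.finrank_zeroLocusCohomology_one])
    exact ⟨(Gm.deRhamCohomologyOneEquiv ℂ).trans e⟩
  · haveI := Gm.subsingleton_deRhamCohomology_add_two ℂ p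
    haveI : Subsingleton (singularCohomology ℂ ℂ (MvPolynomial.zeroLocus ℂ (Gm.gmIdeal ℂ)) (p + 2)) :=
      ModuleCat.subsingleton_of_isZero
        ((Gm.isZero_circleCohomology (p := p + 2) (by omega)).of_iso (Gm.zeroLocusCohomologyIso (p + 2)))
    exact ⟨LinearEquiv.ofSubsingleton _ _⟩

/-- The proved instance in the shape of the fact: `AffineAlgebraicDeRham` holds for the ideal
`(xy − 1)` of `ℂ[x, y]` (with or without the smoothness hypothesis, which it satisfies).
[cite: Grothendieck1966, Thm 1] -/
theorem of_eq_gmIdeal {I : Ideal (MvPolynomial (Fin 2) ℂ)} (hI : I = Ideal.span {X 0 * X 1 - 1})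
    (p : ℕ) :
    Nonempty (DeRhamCohomology I p ≃ₗ[ℂ] singularCohomology ℂ ℂ (MvPolynomial.zeroLocus ℂ I) p) := by
  subst hI
  exact gm p

end AffineAlgebraicDeRham

end Literature.AlgebraicGeometry.Motives

end
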